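import Literature.Probability.RandomPlanarGeometry.SAWWords
import HarnessLib

/-!
# Directed self-avoiding walks on the Manhattan lattice: `c^M_{n+m} ≤ c^M_n c^M_m` and `μ_M`

Topic `Literature/Probability/RandomPlanarGeometry` (continues `SAWCount.lean` — `Zd.saws`, `Zd.mem_saws`,
`Zd.count_add_le` — in dimension `2`).

## What the sources print

* A. Malakis, *Self-avoiding walks on oriented square lattices*, J. Phys. A 8 (1975) 1885–1898, abstract:
  "An analysis is undertaken of the self-avoiding walk problem on two distinct oriented square lattices"
  (the Manhattan lattice and the `L` lattice); "Rigorous upper and lower bounds together with estimates are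
  presented for the connective constant `μ` … for both the oriented square lattices."
* T. Kennedy, *A non-intersecting random walk on the Manhattan lattice and SLE₆*, J. Stat. Phys. 174 (2019)
  77–96 (arXiv:1803.06728), §1: "The Manhattan lattice is an oriented square lattice in which the orientations
  are constant along horizontal and vertical lines and alternate as we move up or down from a horizontal line
  or right or left from a vertical line."
* N. Madras, G. Slade, *The Self-Avoiding Walk* (1993), §1.2, eq. (1.2.3) and Lemma 1.2.2: submultiplicativity
  `c_{n+m} ≤ c_n c_m` and Fekete's lemma give `μ = lim c_n^{1/n} = inf c_n^{1/n}`.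

## What is here (namespace `Literature.Probability.RandomPlanarGeometry.SAW.Zd`)

* `IsManhattanArc x y` — the arc relation of the Manhattan orientation of `ℤ²` (street `x₁ = k` points `+x`
  iff `k` is even; avenue `x₀ = k` points `+y` iff `k` is odd); `manhattanWalks N` — the `N`-step DIRECTED
  self-avoiding walks from `0` (a `Finset.filter` of the tree's `saws 2 N`); `manhattanCount N = c^M_N`
  (`2, 4, 8, 14, 26, 48, 88, 154, 278, 500, 900, 1576, …`, twice OEIS A006744); `logMuM = inf_N log c^M_{N+1}/(N+1)`.
* `manhattanShift a` — the lattice symmetry `(x, y) ↦ ((-1)^{a₁} (x − a₀), (-1)^{a₀} (y − a₁))` of `ℤ²`; it maps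
  `a` to `0` and PRESERVES the Manhattan orientation (`isManhattanArc_manhattanShift`): the Manhattan lattice is
  vertex-transitive although it is not invariant under unit translations.
* **`manhattanCount_add_le` — `c^M_{n+m} ≤ c^M_n · c^M_m`** (split after `n` steps and move the second piece to
  the origin by `manhattanShift (ω n)`), `one_le_manhattanCount`, and Fekete:
  **`tendsto_log_manhattanCount_div` — `log c^M_N / N → log μ_M = logMuM`**.

The lower bound `81/50 ≤ μ_M` (block language) and the comparison with the `L`, hexagonal and square lattices
are in the sequel files `SAWManhattanBlocks.lean` / `SAWPlanarConnectiveConstants.lean`.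
-/

noncomputable section

open Finset Filter
open scoped Topology BigOperators
open Literature.Probability.LatticeModels Literature.Probability.Percolation SimpleGraph

namespace Literature.Probability.RandomPlanarGeometry.SAW.Zd

/-! ### The Manhattan orientation of `ℤ²` -/

/-- **The arcs of the Manhattan lattice.** `IsManhattanArc x y`: `x ∼ y` in `ℤ²`, and the step `x → y`, if
horizontal (along the street `x₁`), points `+x` iff the street index `x₁` is even, and if vertical (along the
avenue `x₀`), points `+y` iff the avenue index `x₀` is odd — "the orientations are constant along horizontal
and vertical lines and alternate as we move up or down from a horizontal line or right or left from a vertical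
line" (Kennedy, §1; we fix the orientation class with the street `x₁ = 0` east-bound and the avenue `x₀ = 0`
south-bound). [cite: Kennedy2018ManhattanSLE6, §1 (p. 4)] [cite: Malakis1975, abstract] -/
def IsManhattanArc (x y : Site 2) : Prop :=
  (zdGraph 2).Adj x y ∧ ((y - x) 1 = 0 → ((y - x) 0 = 1 ↔ Even (x 1))) ∧
    ((y - x) 0 = 0 → ((y - x) 1 = 1 ↔ ¬ Even (x 0)))

open Classical in
/-- **Directed self-avoiding walks on the Manhattan lattice**: the `N`-step self-avoiding walks from `0` on `ℤ²`
all of whose steps are Manhattan arcs (the walks counted by Malakis' `C_N` for the Manhattan lattice, per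
starting site). [cite: Malakis1975, abstract] [cite: Kennedy2018ManhattanSLE6, p. 4] -/
def manhattanWalks (N : ℕ) : Finset (ℕ → Site 2) :=
  (Zd.saws 2 N).filter fun ω => ∀ j, j < N → IsManhattanArc (ω j) (ω (j + 1))

/-- `c^M_N`, the number of `N`-step directed self-avoiding walks from a site of the Manhattan lattice
(`2, 4, 8, 14, 26, 48, 88, 154, 278, 500, 900, 1576, 2806, 4996, …`). [cite: Malakis1975, abstract] -/
def manhattanCount (N : ℕ) : ℕ := (manhattanWalks N).card

/-- `log μ_M := inf_N log c^M_{N+1} / (N+1)`, the logarithm of the Manhattan-lattice connective constant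
(a limit by Fekete's lemma, `tendsto_log_manhattanCount_div`). [cite: Malakis1975, abstract]
[cite: MadrasSlade1993, §1.2, eq. (1.2.9)] -/
def logMuM : ℝ := ⨅ N : ℕ, Real.log (manhattanCount (N + 1)) / ((N : ℝ) + 1)

/-- `manhattanWalks N ⊆ saws 2 N`. [cite: Malakis1975, abstract] -/
theorem manhattanWalks_subset_saws (N : ℕ) : manhattanWalks N ⊆ saws 2 N := by
  classical
  unfold manhattanWalks
  exact Finset.filter_subset _ _

/-- Membership in `manhattanWalks N`. [cite: Malakis1975, abstract] -/
theorem mem_manhattanWalks {N : ℕ} {ω : ℕ → Site 2} :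
    ω ∈ manhattanWalks N ↔ ω ∈ saws 2 N ∧ ∀ j, j < N → IsManhattanArc (ω j) (ω (j + 1)) := by
  classical
  unfold manhattanWalks
  rw [Finset.mem_filter]

/-! ### Adjacency of `ℤ²` in coordinates -/

/-- Adjacency in `ℤ²` in coordinates: one coordinate changes by `±1`, the other is unchanged (the steps of a
nearest-neighbour walk are the unit vectors `±e₁, ±e₂`). [cite: MadrasSlade1993, §1.1] -/
theorem adj_two_iff_coord (x y : Site 2) :
    (zdGraph 2).Adj x y ↔
      ((y 0 - x 0 = 1 ∨ y 0 - x 0 = -1) ∧ y 1 = x 1) ∨ (y 0 = x 0 ∧ (y 1 - x 1 = 1 ∨ y 1 - x 1 = -1)) := by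
  rw [zdGraph_adj_iff]
  constructor
  · rintro ⟨i, hi | hi⟩
    · have h0 := congrFun hi 0
      have h1 := congrFun hi 1
      fin_cases i <;> simp at h0 h1 <;> omega
    · have h0 := congrFun hi 0
      have h1 := congrFun hi 1
      fin_cases i <;> simp at h0 h1 <;> omega
  · rintro (⟨h0 | h0, h1⟩ | ⟨h0, h1 | h1⟩)
    · refine ⟨0, Or.inl ?_⟩
      funext j; fin_cases j <;> simp <;> omega
    · refine ⟨0, Or.inr ?_⟩
      funext j; fin_cases j <;> simp <;> omega
    · refine ⟨1, Or.inl ?_⟩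
      funext j; fin_cases j <;> simp <;> omega
    · refine ⟨1, Or.inr ?_⟩
      funext j; fin_cases j <;> simp <;> omega

/-! ### The symmetries of the Manhattan lattice -/

/-- `(-1)^n` as an integer sign. [folklore] -/
def msign (n : ℤ) : ℤ := if Even n then 1 else -1

/-- `msign n = 1` for even `n`. [folklore] -/
private theorem msign_of_even {n : ℤ} (h : Even n) : msign n = 1 := if_pos h

/-- `msign n = -1` for odd `n`. [folklore] -/
private theorem msign_of_not_even {n : ℤ} (h : ¬ Even n) : msign n = -1 := if_neg h

/-- `msign n = 1` if `n % 2 = 0`. [folklore] -/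
private theorem msign_of_emod_two_eq_zero {n : ℤ} (h : n % 2 = 0) : msign n = 1 := msign_of_even (Int.even_iff.2 h)

/-- `msign n = -1` if `n % 2 = 1`. [folklore] -/
private theorem msign_of_emod_two_eq_one {n : ℤ} (h : n % 2 = 1) : msign n = -1 :=
  msign_of_not_even fun he => by have := Int.even_iff.1 he; omega

/-- `msign n ∈ {1, -1}`. [folklore] -/
private theorem msign_eq_or (n : ℤ) : msign n = 1 ∨ msign n = -1 := by
  by_cases h : Even n
  · exact Or.inl (msign_of_even h)
  · exact Or.inr (msign_of_not_even h)

/-- `msign n * msign n = 1`. [folklore] -/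
private theorem msign_mul_self (n : ℤ) : msign n * msign n = 1 := by
  rcases msign_eq_or n with h | h <;> simp [h]

/-- **The Manhattan symmetry moving `a` to the origin**: `(x, y) ↦ ((-1)^{a₁} (x − a₀), (-1)^{a₀} (y − a₁))`.
Translating by `−a` alone would flip the orientation of the streets (if `a₁` is odd) and of the avenues (if
`a₀` is odd); composing with the corresponding coordinate reflections restores it
(`isManhattanArc_manhattanShift`). [cite: Kennedy2018ManhattanSLE6, p. 4] -/
def manhattanShift (a p : Site 2) : Site 2 := ![msign (a 1) * (p 0 - a 0), msign (a 0) * (p 1 - a 1)]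

/-- First coordinate of `manhattanShift a p`. [cite: Kennedy2018ManhattanSLE6, p. 4] -/
@[simp] theorem manhattanShift_apply_zero (a p : Site 2) :
    manhattanShift a p 0 = msign (a 1) * (p 0 - a 0) := rfl

/-- Second coordinate of `manhattanShift a p`. [cite: Kennedy2018ManhattanSLE6, p. 4] -/
@[simp] theorem manhattanShift_apply_one (a p : Site 2) :
    manhattanShift a p 1 = msign (a 0) * (p 1 - a 1) := rfl

/-- `manhattanShift a a = 0`: the symmetry moves `a` to the origin. [cite: Kennedy2018ManhattanSLE6, p. 4] -/
@[simp] theorem manhattanShift_self (a : Site 2) : manhattanShift a a = 0 := by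
  funext j; fin_cases j <;> simp

/-- `manhattanShift a` is injective (it is an involution up to translation). [cite: Kennedy2018ManhattanSLE6, p. 4] -/
theorem manhattanShift_injective (a : Site 2) : Function.Injective (manhattanShift a) := by
  intro p q h
  have h0 := congrFun h 0
  have h1 := congrFun h 1
  simp only [manhattanShift_apply_zero, manhattanShift_apply_one] at h0 h1
  funext j
  fin_cases j
  · have := congrArg (fun t => msign (a 1) * t) h0
    simp only [← mul_assoc, msign_mul_self, one_mul] at this
    simpa using this
  · have := congrArg (fun t => msign (a 0) * t) h1
    simp only [← mul_assoc, msign_mul_self, one_mul] at this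
    simpa using this

/-- `manhattanShift a` preserves adjacency of `ℤ²` (it is a lattice symmetry). [cite: Kennedy2018ManhattanSLE6, p. 4] -/
theorem adj_manhattanShift {a x y : Site 2} (h : (zdGraph 2).Adj x y) :
    (zdGraph 2).Adj (manhattanShift a x) (manhattanShift a y) := by
  rw [adj_two_iff_coord] at h ⊢
  simp only [manhattanShift_apply_zero, manhattanShift_apply_one]
  rcases msign_eq_or (a 0) with h0 | h0 <;> rcases msign_eq_or (a 1) with h1 | h1 <;>
    simp only [h0, h1, one_mul, neg_one_mul] <;> omega

/-- **`manhattanShift a` preserves the Manhattan orientation.** [cite: Kennedy2018ManhattanSLE6, p. 4] -/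
theorem isManhattanArc_manhattanShift {a x y : Site 2} (h : IsManhattanArc x y) :
    IsManhattanArc (manhattanShift a x) (manhattanShift a y) := by
  obtain ⟨hadj, hh, hv⟩ := h
  refine ⟨adj_manhattanShift hadj, ?_⟩
  rw [adj_two_iff_coord] at hadj
  simp only [Pi.sub_apply, manhattanShift_apply_zero, manhattanShift_apply_one] at hh hv ⊢
  simp only [Int.even_iff] at hh hv ⊢
  rcases Int.emod_two_eq_zero_or_one (a 0) with ha0 | ha0 <;>
    rcases Int.emod_two_eq_zero_or_one (a 1) with ha1 | ha1 <;>
    simp only [msign_of_emod_two_eq_zero, msign_of_emod_two_eq_one, ha0, ha1, one_mul, neg_one_mul] <;>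
    omega

/-! ### Submultiplicativity `c^M_{n+m} ≤ c^M_n · c^M_m` -/

/-- **`c^M_{n+m} ≤ c^M_n · c^M_m`**: a directed `(n+m)`-step self-avoiding walk splits into its first `n` steps and
its last `m` steps, the latter moved to the origin by the Manhattan symmetry `manhattanShift (ω n)`; the pair
determines the walk. (Madras–Slade (1.2.3) for the Manhattan lattice, which is vertex-transitive under these
symmetries.) [cite: MadrasSlade1993, §1.2, eq. (1.2.3)] [cite: Malakis1975, abstract] -/
theorem manhattanCount_add_le (n m : ℕ) :
    manhattanCount (n + m) ≤ manhattanCount n * manhattanCount m := by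
  classical
  unfold manhattanCount
  rw [← Finset.card_product]
  refine Finset.card_le_card_of_injOn
    (fun ω => (fun i => ω (min i n), fun i => manhattanShift (ω n) (ω (n + min i m)))) ?_ ?_
  · intro ω hω
    rw [Finset.mem_coe, mem_manhattanWalks, mem_saws] at hω
    obtain ⟨⟨h0, hend, hadj, hinj⟩, harc⟩ := hω
    rw [Finset.mem_coe, Finset.mem_product]
    refine ⟨mem_manhattanWalks.2 ⟨mem_saws.2 ⟨by simpa using h0, ?_, ?_, ?_⟩, ?_⟩,
      mem_manhattanWalks.2 ⟨mem_saws.2 ⟨by simp, ?_, ?_, ?_⟩, ?_⟩⟩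
    · intro i hi
      simp [min_eq_right hi]
    · intro i hi
      have h1 : min i n = i := min_eq_left hi.le
      have h2 : min (i + 1) n = i + 1 := min_eq_left (by omega)
      simp only [h1, h2]
      exact hadj i (by omega)
    · intro i hi j hj hij
      simp only [Set.mem_setOf_eq] at hi hj
      simp only [min_eq_left hi, min_eq_left hj] at hij
      exact hinj (by simp only [Set.mem_setOf_eq]; omega)
        (by simp only [Set.mem_setOf_eq]; omega) hij
    · intro j hj
      have h1 : min j n = j := min_eq_left hj.le
      have h2 : min (j + 1) n = j + 1 := min_eq_left (by omega)
      simp only [h1, h2]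
      exact harc j (by omega)
    · intro i hi
      simp [min_eq_right hi]
    · intro i hi
      have h1 : min i m = i := min_eq_left hi.le
      have h2 : min (i + 1) m = i + 1 := min_eq_left (by omega)
      simp only [h1, h2]
      have := adj_manhattanShift (a := ω n) (hadj (n + i) (by omega))
      rwa [show n + i + 1 = n + (i + 1) by omega] at this
    · intro i hi j hj hij
      simp only [Set.mem_setOf_eq] at hi hj
      simp only [min_eq_left hi, min_eq_left hj] at hij
      have hij' := manhattanShift_injective (ω n) hij
      have := hinj (by simp only [Set.mem_setOf_eq]; omega)
        (by simp only [Set.mem_setOf_eq]; omega) hij'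
      omega
    · intro j hj
      have h1 : min j m = j := min_eq_left hj.le
      have h2 : min (j + 1) m = j + 1 := min_eq_left (by omega)
      simp only [h1, h2]
      have := isManhattanArc_manhattanShift (a := ω n) (harc (n + j) (by omega))
      rwa [show n + j + 1 = n + (j + 1) by omega] at this
  · intro ω hω ω' hω' h
    rw [Finset.mem_coe, mem_manhattanWalks, mem_saws] at hω hω'
    simp only [Prod.mk.injEq] at h
    obtain ⟨h1, h2⟩ := h
    have hn : ω n = ω' n := by simpa using congrFun h1 n
    funext i
    rcases le_or_gt i n with hi | hi
    · simpa [min_eq_left hi] using congrFun h1 i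
    · obtain ⟨k, rfl⟩ : ∃ k, i = n + k := ⟨i - n, by omega⟩
      rcases le_or_gt k m with hk | hk
      · have := congrFun h2 k
        simp only [min_eq_left hk] at this
        rw [hn] at this
        exact manhattanShift_injective _ this
      · have := congrFun h2 m
        simp only [min_self] at this
        rw [hn] at this
        have hm := manhattanShift_injective _ this
        rw [hω.1.2.1 (n + k) (by omega), hω'.1.2.1 (n + k) (by omega), hm]

/-! ### `c^M_N ≥ 1` and Fekete: `log c^M_N / N → log μ_M` -/

/-- The straight walk along the street `x₁ = 0` (oriented `+x`) is a directed Manhattan walk. [cite: Malakis1975, abstract] -/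
theorem straightWalk_mem_manhattanWalks (N : ℕ) : straightWalk 2 N ∈ manhattanWalks N := by
  refine mem_manhattanWalks.2 ⟨straightWalk_mem_saws 2 N, fun j hj => ?_⟩
  have h1 : min j N = j := min_eq_left hj.le
  have h2 : min (j + 1) N = j + 1 := min_eq_left (by omega)
  refine ⟨(mem_saws.1 (straightWalk_mem_saws 2 N)).2.2.1 j hj, ?_, ?_⟩
  · intro _
    simp [straightWalk, h1, h2]
  · intro h
    simp [straightWalk, h1, h2] at h

/-- `c^M_N ≥ 1`. [cite: Malakis1975, abstract] -/
theorem one_le_manhattanCount (N : ℕ) : 1 ≤ manhattanCount N :=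
  Finset.card_pos.2 ⟨_, straightWalk_mem_manhattanWalks N⟩

/-- `N ↦ log c^M_N` is subadditive. [cite: MadrasSlade1993, §1.2, Lemma 1.2.2] -/
theorem subadditive_log_manhattanCount : Subadditive fun n : ℕ => Real.log (manhattanCount n) := by
  intro m n
  have hm : (0 : ℝ) < manhattanCount m := by exact_mod_cast one_le_manhattanCount m
  have hn : (0 : ℝ) < manhattanCount n := by exact_mod_cast one_le_manhattanCount n
  have hmn : (0 : ℝ) < manhattanCount (m + n) := by exact_mod_cast one_le_manhattanCount (m + n)
  have h' : (manhattanCount (m + n) : ℝ) ≤ (manhattanCount m : ℝ) * manhattanCount n := by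
    exact_mod_cast manhattanCount_add_le m n
  have := Real.log_le_log hmn h'
  rwa [Real.log_mul hm.ne' hn.ne'] at this

/-- `log μ_M` is Fekete's limit of the subadditive sequence `log c^M_N`. [cite: MadrasSlade1993, §1.2, Lemma 1.2.2] -/
theorem logMuM_eq_lim : logMuM = subadditive_log_manhattanCount.lim := by
  rw [Subadditive.lim, logMuM, iInf]
  congr 1
  ext x
  simp only [Set.mem_range, Set.mem_image, Set.mem_Ici]
  constructor
  · rintro ⟨N, rfl⟩
    exact ⟨N + 1, by omega, by push_cast; rfl⟩
  · rintro ⟨n, hn, rfl⟩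
    obtain ⟨N, rfl⟩ : ∃ N, n = N + 1 := ⟨n - 1, by omega⟩
    exact ⟨N, by push_cast; rfl⟩

/-- **Fekete for the Manhattan counts: `log c^M_N / N → log μ_M`** (so `μ_M = lim (c^M_N)^{1/N} = inf (c^M_N)^{1/N}`).
[cite: MadrasSlade1993, §1.2, Lemma 1.2.2] [cite: Malakis1975, abstract] -/
theorem tendsto_log_manhattanCount_div :
    Tendsto (fun n : ℕ => Real.log (manhattanCount n) / n) atTop (𝓝 logMuM) := by
  rw [logMuM_eq_lim]
  refine subadditive_log_manhattanCount.tendsto_lim ⟨0, ?_⟩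
  rintro _ ⟨n, rfl⟩
  exact div_nonneg (Real.log_natCast_nonneg _) (Nat.cast_nonneg n)

/-- `log μ_M ≤ log c^M_{N+1} / (N+1)` for every `N` (the infimum is below each term). [cite: MadrasSlade1993, §1.2, eq. (1.2.9)] -/
theorem logMuM_le (N : ℕ) : logMuM ≤ Real.log (manhattanCount (N + 1)) / ((N : ℝ) + 1) := by
  have hbdd : BddBelow (Set.range fun N : ℕ => Real.log (manhattanCount (N + 1)) / ((N : ℝ) + 1)) :=
    ⟨0, by rintro _ ⟨N, rfl⟩; exact div_nonneg (Real.log_natCast_nonneg _) (by positivity)⟩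
  exact ciInf_le hbdd N

end Literature.Probability.RandomPlanarGeometry.SAW.Zd

end
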